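/-
Origin: expansion seat `planner-pub-hodgecm-pv01-g5-0`, handover #2 2026-08-18T07:26:43Z (`HOME/pub-hodgecm-pv01-g5/lean/Pv01g5/EndStateShadow.lean`, md5 01fb893f, 315 lines);
landed by the gen-7 packager in gate run 26 as `HodgeCM/PerL34/EndStateShadow.lean` (verbatim).
-/
/-
Origin: planner-pub-hodgecm-pv01-g5-0 (unit pub-hodgecm-pv01-g5, DAG-NODE PROVER #01 gen 5), 2026-08-18.
Proposed tree path: `HodgeCM/PerL34/EndStateShadow.lean` (new, additive leaf; fresh namespace
`HodgeCM.PerL34.EndStateShadow` + dot-declarations `…toPeriodFree` / `…ofPeriodFree` on the record types it transports).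
Imports the LANDED `HodgeCM.PerL34.CharSpansFinal` (headline, r23), `HodgeCM.Model.PerLInhabited` (toy2: `periodFree`,
`toPeriodFree`, `not_perL_periodFree`), `HodgeCM.Proofs.LandherrDischarge` (r22: `lemma33bLandherr_holds`), `HodgeCM.Assembly.CorCM`.
KERNEL: nothing cited, nothing asserted.
-/
import Summits.HodgeConjecture.HodgeCM.PerL34.CharSpansFinal
import Summits.HodgeConjecture.HodgeCM.Model.PerLInhabited
import Summits.HodgeConjecture.HodgeCM.Proofs.LandherrDischarge
import Summits.HodgeConjecture.HodgeCM.Assembly.CorCM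

/-!
# The period-free shadow AT HEADLINE LEVEL

toy2's `Model/NonVacuity.lean` proved: the period-free shadow `U⁰ := U.periodFree` (same varieties, morphisms,
cohomology, Hodge filtration and CM actions; trace `:= 0`) keeps the 28 facts `ModelAxioms` and the nine trace-free
theta facts of prl1's record `T.Inputs`, and refutes `Fact_innerEmb`, `Fact_hodgeRiemann20`, `RealisationExistsFace`,
rfwf Thm 4.1 — for the RECORD-LEVEL route `realisationExistsPerL_of'`.

This file lifts that to the END STATE, i.e. to the exact binder list of the headline
`AssemblyRoutes.perL_of_openCharsWeilLeavesCRΔ (M T h07 h09a h09b hM38 hAlb h12b hbr hQ Pc A12 A34 hch hW) : U.PerL`: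

§1 TRANSPORT.  Eleven of the thirteen non-`M` binders are TRACE-FREE: each is transported VERBATIM along
   `(U, T) ↦ (U⁰, T.toPeriodFree)` — the Props by `Iff.rfl` up to the `GoodCtx` re-packing, the four RECORD types
   (`SeesawBridge`, `QautBridge`, `CharLineSpansCR`, `WeilPackageCR`) by the anonymous re-typing `{ B with }` (every
   field keeps its term; only the universe index of the structure changes), `PointedCore` / `ArchCDatum` need nothing
   (their parameters `T.core V c`, `T.t12 V c` are definitionally those of `T.toPeriodFree`).
§2 SEPARATION.  `separating_headline`: if `(U, T)` carries the headline's full binder list then `(U⁰, T⁰)` carries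
   `ModelAxioms` and the ELEVEN trace-free binders and refutes BOTH remaining ones — `h07 = Fact_hodgeRiemann20` and
   `h09b = Fact_innerEmb` — together with `PerL`, `PerL44`, both realisation inputs and `PeriodThmF`.
   Hence `exists_model_headline_not_h07_h09b`: {h07, h09b} is INDEPENDENT of `M` + the other eleven binders (relative to
   the consistency of the end state, exactly as toy2's `exists_model_not_innerEmb_hodgeRiemann` is relative to that of
   the record), and `periodFree_not_headline`: NO period-free universe — in particular no toy universe of
   `Model/Toy*.lean`, all of which are period-free (`toyModelWith_periodFree`) — carries a theta model with the full list.
   So an ABSOLUTE consistency witness of the end state must have non-zero periods AND satisfy M26/M27/M18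
   (`gysin_surface`, `deg_diag`, `lift`) non-trivially: it is the model programme (GAPS `carverg2-X1`), not a toy.

What this file does NOT claim: that the end state is consistent; any statement about the intended model.
-/

set_option autoImplicit false

noncomputable section

open HodgeCM.Prior.Perl34File HodgeCM.Prior.Perl34File.Perl34 HodgeCM.PerL34.ArchC

namespace HodgeCM

/-! ## §1 Transport of the trace-free binders along `(U,T) ↦ (U⁰, T⁰)` -/

namespace Universe

variable {U : Universe}

/-- M38 is trace-free. -/
theorem periodFree_fact_cmInflation_iff : U.periodFree.Fact_cmInflation ↔ U.Fact_cmInflation := Iff.rfl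

namespace ThetaModel

variable (T : U.ThetaModel)

/-- `Fact_thetaAlbanese` (the [Liu21] interface, binder `hAlb`) is trace-free. -/
theorem toPeriodFree_thetaAlbanese_iff : T.toPeriodFree.Fact_thetaAlbanese ↔ T.Fact_thetaAlbanese :=
  ⟨fun h _ ι₁ V c hc => h V c ((T.toPeriodFree_goodCtx_iff ι₁ c).mpr hc),
    fun h _ ι₁ V c hc => h V c ((T.toPeriodFree_goodCtx_iff ι₁ c).mp hc)⟩

/-- N09a (binder `h09a`) is trace-free. -/
theorem toPeriodFree_N09a_iff : PerL34.N09a_embCover T.toPeriodFree ↔ PerL34.N09a_embCover T := Iff.rfl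

/-- N12b (binder `h12b`) is trace-free. -/
theorem toPeriodFree_N12b_iff : PerL34.N12b_signRecipe T.toPeriodFree ↔ PerL34.N12b_signRecipe T := Iff.rfl

/-- N09b over the shadow IS `Fact_innerEmb` of the shadow (names only). -/
theorem toPeriodFree_N09b_iff : PerL34.N09b_innerEmb T.toPeriodFree ↔ T.toPeriodFree.Fact_innerEmb := Iff.rfl

end ThetaModel

end Universe

namespace PerL34

variable {U : Universe} {T : U.ThetaModel}
variable {L : CMField} {ι₁ : L →+* ℂ} {V : HermSpace3 L ι₁} {c : SeesawCtx L}

namespace SeesawDictionary.SeesawBridge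

variable {D : Perl34.TorusData (T.core V c)} {k l : Fin 4}

/-- The S5 bridge record (side `(k,l)`), re-read over the shadow: every field verbatim. -/
def toPeriodFree (B : SeesawBridge T V c D k l) : SeesawBridge T.toPeriodFree V c D k l := { B with }

/-- … and back. -/
def ofPeriodFree (B : SeesawBridge T.toPeriodFree V c D k l) : SeesawBridge T V c D k l := { B with }

/-- (Ported verbatim from the HodgeCMPerL package; no docstring in the source.) -/
theorem nonempty_toPeriodFree_iff :
    Nonempty (SeesawBridge T.toPeriodFree V c D k l) ↔ Nonempty (SeesawBridge T V c D k l) :=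
  ⟨fun ⟨B⟩ => ⟨B.ofPeriodFree⟩, fun ⟨B⟩ => ⟨B.toPeriodFree⟩⟩

end SeesawDictionary.SeesawBridge

namespace QautDictionary.QautBridge

variable {D : Perl34.TorusData (T.core V c)} {k l : Fin 4}

/-- The S5 `Qaut` bridge record (side `(k,l)`), re-read over the shadow: every field verbatim. -/
def toPeriodFree (B : QautBridge T V c D k l) : QautBridge T.toPeriodFree V c D k l := { B with }

/-- … and back. -/
def ofPeriodFree (B : QautBridge T.toPeriodFree V c D k l) : QautBridge T V c D k l := { B with }

/-- (Ported verbatim from the HodgeCMPerL package; no docstring in the source.) -/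
theorem nonempty_toPeriodFree_iff :
    Nonempty (QautBridge T.toPeriodFree V c D k l) ↔ Nonempty (QautBridge T V c D k l) :=
  ⟨fun ⟨B⟩ => ⟨B.ofPeriodFree⟩, fun ⟨B⟩ => ⟨B.toPeriodFree⟩⟩

end QautDictionary.QautBridge

namespace CharSpansCR.CharLineSpansCR

/-- pv02's CR forms-dictionary data, re-read over the shadow. -/
def toPeriodFree (M : CharLineSpansCR T V c) : CharLineSpansCR T.toPeriodFree V c := { M with }

/-- … and back. -/
def ofPeriodFree (M : CharLineSpansCR T.toPeriodFree V c) : CharLineSpansCR T V c := { M with }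

end CharSpansCR.CharLineSpansCR

namespace CharSpansCR.WeilPackageCR

/-- pv03/pv14's Weil package over the CR data, re-read over the shadow. -/
def toPeriodFree {M : CharLineSpansCR T V c} (P : WeilPackageCR T M) :
    WeilPackageCR T.toPeriodFree M.toPeriodFree := { P with }

/-- … and back. -/
def ofPeriodFree {M : CharLineSpansCR T.toPeriodFree V c} (P : WeilPackageCR T.toPeriodFree M) :
    WeilPackageCR T M.ofPeriodFree := { P with }

end CharSpansCR.WeilPackageCR

namespace CharSpansFinal

variable (T)

/-- **The S1 binder `hW` is trace-free.** -/
theorem toPeriodFree_weilStepsInputCRΔ_iff : WeilStepsInputCRΔ T.toPeriodFree ↔ WeilStepsInputCRΔ T := by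
  refine ⟨fun h _ ι₁ V c hc => ?_, fun h _ ι₁ V c hc => ?_⟩
  · obtain ⟨M, ⟨P⟩, ⟨Tfr, hT, ψ, hΓ⟩, h₀, h₁, hcup⟩ := h V c ((T.toPeriodFree_goodCtx_iff ι₁ c).mpr hc)
    exact ⟨M.ofPeriodFree, ⟨P.ofPeriodFree⟩, ⟨Tfr, hT, ψ, hΓ⟩, h₀, h₁, hcup⟩
  · obtain ⟨M, ⟨P⟩, ⟨Tfr, hT, ψ, hΓ⟩, h₀, h₁, hcup⟩ := h V c ((T.toPeriodFree_goodCtx_iff ι₁ c).mp hc)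
    exact ⟨M.toPeriodFree, ⟨P.toPeriodFree⟩, ⟨Tfr, hT, ψ, hΓ⟩, h₀, h₁, hcup⟩

end CharSpansFinal

/-! ## §2 The end state and its shadow -/

namespace EndStateShadow

open AssemblyRoutes

variable (T)

/-- **The END STATE**: the thirteen non-`M` binders of the headline
`AssemblyRoutes.perL_of_openCharsWeilLeavesCRΔ`, verbatim (types, order), bundled as one proposition; the data binder
`Pc` (pointed extensions of the isolation cores) is the parameter. -/
structure EndState
    (Pc : ∀ {L : CMField} {ι₁ : L →+* ℂ} (V : HermSpace3 L ι₁) (c : SeesawCtx L),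
      C4a.PointedCore (T.core V c)) : Prop where
  h07 : N07_hodgeRiemann20 U
  h09a : N09a_embCover T
  h09b : N09b_innerEmb T
  hM38 : U.Fact_cmInflation
  hAlb : T.Fact_thetaAlbanese
  h12b : N12b_signRecipe T
  hbr : ∀ {L : CMField} {ι₁ : L →+* ℂ} (V : HermSpace3 L ι₁) (c : SeesawCtx L), T.GoodCtx ι₁ c →
    Nonempty (SeesawDictionary.SeesawBridge T V c (T.t12 V c) 0 1)
  hQ : ∀ {L : CMField} {ι₁ : L →+* ℂ} (V : HermSpace3 L ι₁) (c : SeesawCtx L), T.GoodCtx ι₁ c →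
    Nonempty (QautDictionary.QautBridge T V c (T.t34 V c) 2 3)
  A12 : ∀ {L : CMField} {ι₁ : L →+* ℂ} (V : HermSpace3 L ι₁) (c : SeesawCtx L),
    T.GoodCtx ι₁ c → Nonempty (ArchCDatum (T.core V c) (T.t12 V c) (Pc V c))
  A34 : ∀ {L : CMField} {ι₁ : L →+* ℂ} (V : HermSpace3 L ι₁) (c : SeesawCtx L),
    T.GoodCtx ι₁ c → Nonempty (ArchCDatum (T.core V c) (T.t34 V c) (Pc V c))
  hch : T.Open_chars
  hW : CharSpansFinal.WeilStepsInputCRΔ T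

/-- **The TRACE-FREE part of the end state**: the same list without `h07` (Hodge–Riemann `(2,0)`:
`tr(η ∪ η̄) ≠ 0` on `F²H²` of a surface) and `h09b` (`Fact_innerEmb`: Petersson product of `emb`-images
`= c · tr(η ∪ η̄')`), the only two binders whose statements mention the trace `U.tr`. -/
structure EndStateTraceFree
    (Pc : ∀ {L : CMField} {ι₁ : L →+* ℂ} (V : HermSpace3 L ι₁) (c : SeesawCtx L),
      C4a.PointedCore (T.core V c)) : Prop where
  h09a : N09a_embCover T
  hM38 : U.Fact_cmInflation
  hAlb : T.Fact_thetaAlbanese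
  h12b : N12b_signRecipe T
  hbr : ∀ {L : CMField} {ι₁ : L →+* ℂ} (V : HermSpace3 L ι₁) (c : SeesawCtx L), T.GoodCtx ι₁ c →
    Nonempty (SeesawDictionary.SeesawBridge T V c (T.t12 V c) 0 1)
  hQ : ∀ {L : CMField} {ι₁ : L →+* ℂ} (V : HermSpace3 L ι₁) (c : SeesawCtx L), T.GoodCtx ι₁ c →
    Nonempty (QautDictionary.QautBridge T V c (T.t34 V c) 2 3)
  A12 : ∀ {L : CMField} {ι₁ : L →+* ℂ} (V : HermSpace3 L ι₁) (c : SeesawCtx L),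
    T.GoodCtx ι₁ c → Nonempty (ArchCDatum (T.core V c) (T.t12 V c) (Pc V c))
  A34 : ∀ {L : CMField} {ι₁ : L →+* ℂ} (V : HermSpace3 L ι₁) (c : SeesawCtx L),
    T.GoodCtx ι₁ c → Nonempty (ArchCDatum (T.core V c) (T.t34 V c) (Pc V c))
  hch : T.Open_chars
  hW : CharSpansFinal.WeilStepsInputCRΔ T

variable {T}
variable {Pc : ∀ {L : CMField} {ι₁ : L →+* ℂ} (V : HermSpace3 L ι₁) (c : SeesawCtx L),
  C4a.PointedCore (T.core V c)}

/-- (Ported verbatim from the HodgeCMPerL package; no docstring in the source.) -/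
theorem EndState.traceFree (E : EndState T Pc) : EndStateTraceFree T Pc :=
  ⟨E.h09a, E.hM38, E.hAlb, E.h12b, E.hbr, E.hQ, E.A12, E.A34, E.hch, E.hW⟩

/-- (Ported verbatim from the HodgeCMPerL package; no docstring in the source.) -/
theorem endState_iff : EndState T Pc ↔ N07_hodgeRiemann20 U ∧ N09b_innerEmb T ∧ EndStateTraceFree T Pc :=
  ⟨fun E => ⟨E.h07, E.h09b, E.traceFree⟩,
    fun ⟨h07, h09b, E⟩ => ⟨h07, E.h09a, h09b, E.hM38, E.hAlb, E.h12b, E.hbr, E.hQ, E.A12, E.A34, E.hch, E.hW⟩⟩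

/-- `EndState` IS the headline's hypothesis list: PerL from `M` and it, by the headline itself. -/
theorem EndState.perL (M : U.ModelAxioms) (E : EndState T Pc) : U.PerL :=
  AssemblyRoutes.perL_of_openCharsWeilLeavesCRΔ M T E.h07 E.h09a E.h09b E.hM38 E.hAlb E.h12b E.hbr E.hQ Pc E.A12
    E.A34 E.hch E.hW

/-- … and prl1's ten-field record `T.Inputs` (the nodes fed by name, as in `AssemblyRoutes.perL_of_nodes''`). -/
theorem EndState.inputs (M : U.ModelAxioms) (E : EndState T Pc) : T.Inputs :=
  axioms_of_nodes T E.h09a E.h09b (N12a_thetaSub_of_split M T E.hM38 E.hAlb) E.h12b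
    (N19w_wedgeMem_of_bridges_chars T E.hbr E.hch) (N19g_genInWedgeSpan_of_bridges T E.hQ)
    (N29_occ_of_archC T Pc E.A12 E.A34) (N31_chars_of_openChars T E.hch) (N33_wedge_of_CRΔ_chars T E.hch E.hW)

/-- **Transport**: the trace-free part of the end state passes VERBATIM to the shadow `(U⁰, T⁰)` (and back). -/
theorem EndStateTraceFree.toPeriodFree (E : EndStateTraceFree T Pc) : EndStateTraceFree T.toPeriodFree Pc where
  h09a := E.h09a
  hM38 := E.hM38
  hAlb := T.toPeriodFree_thetaAlbanese_iff.mpr E.hAlb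
  h12b := E.h12b
  hbr V c hc := SeesawDictionary.SeesawBridge.nonempty_toPeriodFree_iff.mpr
    (E.hbr V c ((T.toPeriodFree_goodCtx_iff _ c).mp hc))
  hQ V c hc := QautDictionary.QautBridge.nonempty_toPeriodFree_iff.mpr
    (E.hQ V c ((T.toPeriodFree_goodCtx_iff _ c).mp hc))
  A12 V c hc := E.A12 V c ((T.toPeriodFree_goodCtx_iff _ c).mp hc)
  A34 V c hc := E.A34 V c ((T.toPeriodFree_goodCtx_iff _ c).mp hc)
  hch := T.toPeriodFree_chars_iff.mpr E.hch
  hW := (CharSpansFinal.toPeriodFree_weilStepsInputCRΔ_iff T).mpr E.hW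

/-- (Ported verbatim from the HodgeCMPerL package; no docstring in the source.) -/
theorem EndStateTraceFree.ofPeriodFree (E : EndStateTraceFree T.toPeriodFree Pc) : EndStateTraceFree T Pc where
  h09a := E.h09a
  hM38 := E.hM38
  hAlb := T.toPeriodFree_thetaAlbanese_iff.mp E.hAlb
  h12b := E.h12b
  hbr V c hc := SeesawDictionary.SeesawBridge.nonempty_toPeriodFree_iff.mp
    (E.hbr V c ((T.toPeriodFree_goodCtx_iff _ c).mpr hc))
  hQ V c hc := QautDictionary.QautBridge.nonempty_toPeriodFree_iff.mp
    (E.hQ V c ((T.toPeriodFree_goodCtx_iff _ c).mpr hc))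
  A12 V c hc := E.A12 V c ((T.toPeriodFree_goodCtx_iff _ c).mpr hc)
  A34 V c hc := E.A34 V c ((T.toPeriodFree_goodCtx_iff _ c).mpr hc)
  hch := T.toPeriodFree_chars_iff.mp E.hch
  hW := (CharSpansFinal.toPeriodFree_weilStepsInputCRΔ_iff T).mp E.hW

/-- (Ported verbatim from the HodgeCMPerL package; no docstring in the source.) -/
theorem endStateTraceFree_toPeriodFree_iff : EndStateTraceFree T.toPeriodFree Pc ↔ EndStateTraceFree T Pc :=
  ⟨EndStateTraceFree.ofPeriodFree, EndStateTraceFree.toPeriodFree⟩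

/-- **Separating model at headline level.**  If `(U, T)` satisfies the 28 facts and the END STATE, then the shadow
`(U⁰, T⁰)` satisfies the 28 facts and the eleven trace-free binders of the end state, and REFUTES the two remaining
binders `h07` (Hodge–Riemann `(2,0)`) and `h09b` (`Fact_innerEmb`) — as well as `PerL`, Thm 4.4, both realisation
inputs and rfwf Thm 4.1 over `F`.  (toy2's `separating_theta` at record level, fed with `EndState.inputs`.) -/
theorem separating_headline (M : U.ModelAxioms) (E : EndState T Pc) :
    U.periodFree.ModelAxioms ∧ EndStateTraceFree T.toPeriodFree Pc ∧
    ¬ N07_hodgeRiemann20 U.periodFree ∧ ¬ N09b_innerEmb T.toPeriodFree ∧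
    ¬ U.periodFree.PerL ∧ ¬ U.periodFree.PerL44 ∧
    ¬ U.periodFree.RealisationExistsPerL ∧ ¬ U.periodFree.RealisationExistsFace ∧ ¬ U.periodFree.PeriodThmF := by
  obtain ⟨M', -, hI, hH⟩ := Universe.separating_theta M lemma33bLandherr_holds T (E.inputs M) E.h07
  exact ⟨M', E.traceFree.toPeriodFree, hH, hI, U.not_perL_periodFree, U.not_perL44_periodFree,
    U.not_realisationExistsPerL_periodFree M.pull_hodge, U.not_realisationExistsFace_periodFree M.pull_hodge,
    U.not_periodThmF_periodFree⟩

/-- Hence NO end state over the shadow of a model, for ANY theta model over it. -/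
theorem not_endState_periodFree (M : U.ModelAxioms) (T' : U.periodFree.ThetaModel)
    (Pc' : ∀ {L : CMField} {ι₁ : L →+* ℂ} (V : HermSpace3 L ι₁) (c : SeesawCtx L),
      C4a.PointedCore (T'.core V c)) : ¬ EndState T' Pc' :=
  fun E => U.not_perL_periodFree (E.perL M.periodFree)

/-- … and no end state over ANY period-free model (a universe equal to its own shadow — every toy universe of
`Model/Toy*.lean` is such, `toyModelWith_periodFree`): an absolute consistency witness of the end state must have
non-zero periods. -/
theorem not_endState_of_periodFree_eq {W : Universe} (hW : W.periodFree = W) (M : W.ModelAxioms)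
    (T' : W.ThetaModel)
    (Pc' : ∀ {L : CMField} {ι₁ : L →+* ℂ} (V : HermSpace3 L ι₁) (c : SeesawCtx L),
      C4a.PointedCore (T'.core V c)) : ¬ EndState T' Pc' := by
  intro E
  have h : ¬ W.periodFree.PerL := W.not_perL_periodFree
  exact h (hW.symm ▸ E.perL M)

end EndStateShadow

/-- **`h07` and `h09b` are jointly independent of the rest of the end state, and the rest does not give PerL.**
If the 28 facts and the end state are jointly satisfiable (as intended), then there are a universe and a theta model
satisfying the 28 facts and the ELEVEN trace-free binders of the headline in which `N07_hodgeRiemann20`,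
`N09b_innerEmb`, `PerL`, `PerL44`, `RealisationExistsPerL`, `RealisationExistsFace` and `PeriodThmF` all FAIL. -/
theorem exists_model_endStateTraceFree_not_h07_h09b_perL
    (h : ∃ (U : Universe) (T : U.ThetaModel)
      (Pc : ∀ {L : CMField} {ι₁ : L →+* ℂ} (V : HermSpace3 L ι₁) (c : SeesawCtx L),
        C4a.PointedCore (T.core V c)), U.ModelAxioms ∧ EndStateShadow.EndState T Pc) :
    ∃ (U' : Universe) (T' : U'.ThetaModel)
      (Pc' : ∀ {L : CMField} {ι₁ : L →+* ℂ} (V : HermSpace3 L ι₁) (c : SeesawCtx L),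
        C4a.PointedCore (T'.core V c)),
      U'.ModelAxioms ∧ EndStateShadow.EndStateTraceFree T' Pc' ∧
      ¬ N07_hodgeRiemann20 U' ∧ ¬ N09b_innerEmb T' ∧ ¬ U'.PerL ∧ ¬ U'.PerL44 ∧
      ¬ U'.RealisationExistsPerL ∧ ¬ U'.RealisationExistsFace ∧ ¬ U'.PeriodThmF := by
  obtain ⟨U, T, Pc, M, E⟩ := h
  exact ⟨U.periodFree, T.toPeriodFree, Pc, EndStateShadow.separating_headline M E⟩

end PerL34

end HodgeCM

end
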